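/-
Copyright (c) 2026 the pub-hodgecm-mathlib formalisation cell (harness21).  Prover seat hodgecm-mathlib-A-p03 (g24); LEAD F0P3a-plan (g9) WORD T8-41 «(F4)–(F8) PEN 1»,
architect A-p06 (g26); LAYER B_H (B-p14 (g30) census 8d487f29 §3), 2026-09-01.
-/
import Literature.NumberTheory.Automorphic.UnitaryThreeBorelCosetCountQuadratic
import HarnessLib

/-!
# Flicker's Prop. 10 coset counts for a GENERAL off-diagonal ratio `p = B₁∕B₂` (`0 < ord p`, `σp = p`) — the form the `T_H`-clause (LAYER B_H) and type (2) need

Topic `NumberTheory/Automorphic` (road «D-N7-inert», MAP v3 (F4)∕(F11) LAYER B_H); namespace `Literature.NumberTheory.Automorphic.UnitaryGroup`.  THEOREMS ONLY: no definition,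
no named fact, no instance, no notation, no `sorry`; kernel lane.

★ `UnitaryThreeBorelConjugateCongruences` §4, ★ `…BorelCosetCount`, ★ `…BorelCosetCountQuadratic` treat `τ = !![A,0,B₂ϖ^{2j}; 0,b,0; B₂,0,A]` (Flicker's type-(1) torus, `j ≥ 1`).
Flicker's SECOND clause of Prop. 10 (p. 85: «for a regular `t = diag(ε⁻¹(α, βπ∕√D; β√D, α), ι)` in `T_H ⊂ H` … `1`, `(1−q⁻²)q^{4m}` if `1 ≤ m ≤ min([ν∕2],[(1+N₂)∕2])`,
`(1+q⁻¹)q^{ν+2m}` if `ν = 1+N₂ < 2m ≤ 2+2N₂`») concerns corners `!![A,0,B₁; 0,b,0; B₂,0,A]` whose ratio `p := B₁∕B₂` is `(π∕D)·ϖ^{2j}`-like: σ-fixed of POSITIVE, possibly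
ODD, order.  The proofs of the type-(1) files use `p` only through `|p| < 1` (and, in the fourth regime, `σp = p`), so this file re-states them for a general `p`
(`hB₁ : B₁ = B₂ * p`, `hvp : |p| < 1`, `hσp : σ p = p`).  THIS FILE: `…_gen` versions of the five regime lemmas and of the three rigid coset counts; the companion
`…GeneralRatioQuadratic` carries the fourth-regime count `natCard_cosets_regime_four_gen` (= `F · q^m · q^{m−k} · q^{m−1}(q+1)` over ★ `natCard_pairs_norm_quadratic_eq`, which is already stated for a general `p ∈ 𝓂`).
HONEST LABEL: HC_CM is proved only modulo the printed citations until rung 0 closes; no new mathematics — a parameter generalisation of ★ p841010∕p841073∕p841308.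

## References
* [Flicker1998UnitaryFL] Y. Z. Flicker, *Elementary proof of the fundamental lemma for a unitary group*, Canad. J. Math. 50 (1998), 74–98: Prop. 10 pp. 85–86 (both clauses).
* [Rogawski1990] J. D. Rogawski, *Automorphic Representations of Unitary Groups in Three Variables* (1990), §4.9 p. 55.
-/

set_option autoImplicit false

open scoped MatrixGroups WithZero Valued
open Matrix

namespace Literature.NumberTheory.Automorphic

namespace UnitaryGroup

open Literature.NumberTheory.Automorphic.HermitianLattice (unitaryInt mem_unitaryInt_iff LocalConjDatum)
open Literature.NumberTheory.LocalFields.UnramifiedQuadraticNorm IsLocalRing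

variable {K : Type*} [Field K] [Valued K ℤᵐ⁰] {ϖ : K} (σ : K →+* K) {J : Matrix (Fin 3) (Fin 3) K}

/-- **Regime «`m > ν` is empty»** (Flicker p. 86: «if `m > ν`, considering the entries (1,2) and (2,1) we conclude that `j = 0`»): for `j ≥ 1`, conditions (2)(3)(4) force
`|B₂| ≤ |t|`, i.e. `m ≤ ν`. [cite: Flicker1998UnitaryFL, Prop. 10 p. 86] -/
theorem v_B₂_le_of_conditions_gen (hd : LocalConjDatum σ ϖ) {A b n B₁ B₂ x p : K} {m : ℕ} (hvp : Valued.v p < 1) (hB₂ : B₂ ≠ 0)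
    (hn : Valued.v n = 1) (hx : Valued.v x ≤ 1) (hB₁ : B₁ = B₂ * p)
    (h₂ : Valued.v (A - b + n * B₂ * (1 - x)) ≤ Valued.v (ϖ ^ m)) (h₃ : Valued.v (A - b + n * B₂ * (1 + x)) ≤ Valued.v (ϖ ^ m))
    (h₄ : Valued.v (2 * (A - b) + B₁ * n⁻¹ + n * B₂ * (1 - x ^ 2)) ≤ Valued.v (ϖ ^ m) * Valued.v (ϖ ^ m)) :
    Valued.v B₂ ≤ Valued.v (ϖ ^ m) := by
  obtain ⟨hxν, hsν⟩ := v_le_of_two_congruences hd.v2 h₂ h₃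
  have hn0 : n ≠ 0 := fun h => by rw [h, map_zero] at hn; exact zero_ne_one hn
  have ht1 : Valued.v (ϖ ^ m) ≤ 1 := hd.v_pow_le_one m
  have h₄' : Valued.v (2 * (A - b) + B₁ * n⁻¹ + n * B₂ * (1 - x ^ 2)) ≤ Valued.v (ϖ ^ m) :=
    le_trans h₄ (by simpa using mul_le_mul' ht1 (le_refl (Valued.v (ϖ ^ m))))
  -- `nB₂ = 2(A − b + nB₂) − (nB₂x)·x + B₁n⁻¹ − [the (4)-expression]`
  have key : n * B₂ = 2 * (A - b + n * B₂) - (n * B₂ * x) * x + B₁ * n⁻¹ - (2 * (A - b) + B₁ * n⁻¹ + n * B₂ * (1 - x ^ 2)) := by ring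
  have hvnB₂ : Valued.v (n * B₂) = Valued.v B₂ := by rw [map_mul, hn, one_mul]
  have hB₁v : Valued.v (B₁ * n⁻¹) = Valued.v B₂ * Valued.v p := by rw [hB₁, map_mul, map_mul, map_inv₀, hn, inv_one, mul_one]
  have hlt : Valued.v p < 1 := hvp
  by_contra hgt
  push Not at hgt
  -- every term on the right of `key` is `< |B₂|`
  have t1 : Valued.v (2 * (A - b + n * B₂)) < Valued.v B₂ := by rw [map_mul, hd.v2, one_mul]; exact lt_of_le_of_lt hsν hgt
  have t2 : Valued.v ((n * B₂ * x) * x) < Valued.v B₂ := by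
    rw [map_mul]; exact lt_of_le_of_lt (by simpa using mul_le_mul' hxν hx) hgt
  have hB₂pos : 0 < Valued.v B₂ := (Valuation.pos_iff _).2 hB₂
  have t3 : Valued.v (B₁ * n⁻¹) < Valued.v B₂ := by
    rw [hB₁v]; exact mul_lt_of_lt_one_right hB₂pos hlt
  have t4 : Valued.v (2 * (A - b) + B₁ * n⁻¹ + n * B₂ * (1 - x ^ 2)) < Valued.v B₂ := lt_of_le_of_lt h₄' hgt
  have : Valued.v (n * B₂) < Valued.v B₂ := by
    rw [key]
    refine lt_of_le_of_lt (Valuation.map_sub _ _ _) (max_lt ?_ t4)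
    refine lt_of_le_of_lt (Valuation.map_add _ _ _) (max_lt ?_ t3)
    exact lt_of_le_of_lt (Valuation.map_sub _ _ _) (max_lt t1 t2)
  rw [hvnB₂] at this
  exact lt_irrefl _ this


/-- **Regime «everything solves»**: if `|A − b| ≤ |t|²` and `|B₂| ≤ |t|²` (i.e. `2m ≤ N₊`, `2m ≤ ν`) then (4) holds for every unit `n` and integral `x`
(Flicker: «if `m ≤ ν′, ν″`, namely `2m ≤ ν, N₊`, any `u`, `λ₁` make a solution»). [cite: Flicker1998UnitaryFL, Prop. 10 p. 86] -/
theorem condition_four_of_le_sq_gen (hd : LocalConjDatum σ ϖ) {A b n B₁ B₂ x p : K} {m : ℕ} (hvp1 : Valued.v p ≤ 1)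
    (hn : Valued.v n = 1) (hx : Valued.v x ≤ 1) (hB₁ : B₁ = B₂ * p)
    (hs : Valued.v (A - b) ≤ Valued.v (ϖ ^ m) * Valued.v (ϖ ^ m)) (hB₂ : Valued.v B₂ ≤ Valued.v (ϖ ^ m) * Valued.v (ϖ ^ m)) :
    Valued.v (2 * (A - b) + B₁ * n⁻¹ + n * B₂ * (1 - x ^ 2)) ≤ Valued.v (ϖ ^ m) * Valued.v (ϖ ^ m) := by
  have hx2 : Valued.v (1 - x ^ 2) ≤ 1 :=
    le_trans (Valuation.map_sub _ _ _) (max_le (le_of_eq (map_one _)) (by rw [map_pow]; exact pow_le_one' hx 2))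
  have t1 : Valued.v (2 * (A - b)) ≤ Valued.v (ϖ ^ m) * Valued.v (ϖ ^ m) := by rw [map_mul, hd.v2, one_mul]; exact hs
  have t2 : Valued.v (B₁ * n⁻¹) ≤ Valued.v (ϖ ^ m) * Valued.v (ϖ ^ m) := by
    rw [hB₁, map_mul, map_mul, map_inv₀, hn, inv_one, mul_one]
    exact le_trans (by simpa using mul_le_mul' (le_refl (Valued.v B₂)) hvp1) hB₂
  have t3 : Valued.v (n * B₂ * (1 - x ^ 2)) ≤ Valued.v (ϖ ^ m) * Valued.v (ϖ ^ m) := by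
    rw [map_mul, map_mul, hn, one_mul]; exact le_trans (by simpa using mul_le_mul' (le_refl (Valued.v B₂)) hx2) hB₂
  exact le_trans (Valuation.map_add _ _ _) (max_le (le_trans (Valuation.map_add _ _ _) (max_le t1 t2)) t3)


/-- **Regime «`ν′ ≠ ν″`, one of them `< m`» has NO solution**: if `|A − b| ≠ |B₂|` and `max(|A − b|, |B₂|) > |t|²` then (4) fails (for `j ≥ 1`, `1 − x²` a unit)
— the valuations `|2(A−b)| = |A−b|`, `|nB₂(1−x²)| = |B₂|`, `|B₁∕n| < |B₂|` cannot cancel. [cite: Flicker1998UnitaryFL, Prop. 10 p. 86] -/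
theorem not_condition_four_of_ne_gen (hd : LocalConjDatum σ ϖ) {A b n B₁ B₂ x p : K} {m : ℕ} (hvp : Valued.v p < 1) (hB₂0 : B₂ ≠ 0)
    (hn : Valued.v n = 1) (h1x : Valued.v (1 - x ^ 2) = 1) (hB₁ : B₁ = B₂ * p)
    (hne : Valued.v (A - b) ≠ Valued.v B₂) (hbig : Valued.v (ϖ ^ m) * Valued.v (ϖ ^ m) < max (Valued.v (A - b)) (Valued.v B₂)) :
    ¬ Valued.v (2 * (A - b) + B₁ * n⁻¹ + n * B₂ * (1 - x ^ 2)) ≤ Valued.v (ϖ ^ m) * Valued.v (ϖ ^ m) := by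
  intro h₄
  have vX : Valued.v (2 * (A - b)) = Valued.v (A - b) := by rw [map_mul, hd.v2, one_mul]
  have vZ : Valued.v (n * B₂ * (1 - x ^ 2)) = Valued.v B₂ := by rw [map_mul, map_mul, hn, h1x, one_mul, mul_one]
  have hlt : Valued.v p < 1 := hvp
  have hB₂pos : 0 < Valued.v B₂ := (Valuation.pos_iff _).2 hB₂0
  have vY : Valued.v (B₁ * n⁻¹) < Valued.v B₂ := by
    rw [hB₁, map_mul, map_mul, map_inv₀, hn, inv_one, mul_one]
    exact mul_lt_of_lt_one_right hB₂pos hlt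
  have hsum : Valued.v (2 * (A - b) + B₁ * n⁻¹ + n * B₂ * (1 - x ^ 2)) = max (Valued.v (A - b)) (Valued.v B₂) := by
    rcases lt_or_gt_of_ne hne with hlt' | hgt'
    · -- |A − b| < |B₂|: the last term dominates
      rw [max_eq_right hlt'.le]
      have hXY : Valued.v (2 * (A - b) + B₁ * n⁻¹) < Valued.v (n * B₂ * (1 - x ^ 2)) := by
        rw [vZ]; exact lt_of_le_of_lt (Valuation.map_add _ _ _) (max_lt (by rwa [vX]) vY)
      rw [Valuation.map_add_eq_of_lt_right _ hXY, vZ]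
    · -- |B₂| < |A − b|: the first term dominates
      rw [max_eq_left hgt'.le]
      have hYZ : Valued.v (B₁ * n⁻¹ + n * B₂ * (1 - x ^ 2)) < Valued.v (2 * (A - b)) := by
        rw [vX]; exact lt_of_le_of_lt (Valuation.map_add _ _ _) (max_lt (lt_trans vY hgt') (by rwa [vZ]))
      rw [add_assoc, Valuation.map_add_eq_of_lt_left _ hYZ, vX]
  rw [hsum] at h₄
  exact absurd (lt_of_lt_of_le hbig h₄) (lt_irrefl _)


/-- **Regime `ν = N₊ < 2m`: (4) is the QUADRATIC CONGRUENCE in the norm**: `2(A−b) + B₁n⁻¹ + nB₂(1−x²) = (B₂∕n)·(n²(1−x²) + d·n + ϖ^{2j})` with `d = 2(A−b)∕B₂`, so for a unit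
`n`, (4) ⟺ `|B₂|·|n²(1−x²) + d n + ϖ^{2j}| ≤ |t|²` (Flicker's `Δ⁻¹(1 + επ^{2j}Δ²)` form, p. 86). [cite: Flicker1998UnitaryFL, Prop. 10 p. 86] -/
theorem condition_four_iff_quadratic_gen {A b n B₁ B₂ x p : K} {m : ℕ} (hB₂0 : B₂ ≠ 0) (hn : Valued.v n = 1) (hB₁ : B₁ = B₂ * p) :
    Valued.v (2 * (A - b) + B₁ * n⁻¹ + n * B₂ * (1 - x ^ 2)) ≤ Valued.v (ϖ ^ m) * Valued.v (ϖ ^ m) ↔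
      Valued.v B₂ * Valued.v (n ^ 2 * (1 - x ^ 2) + (2 * (A - b) / B₂) * n + p) ≤ Valued.v (ϖ ^ m) * Valued.v (ϖ ^ m) := by
  have hn0 : n ≠ 0 := fun h => by rw [h, map_zero] at hn; exact zero_ne_one hn
  have e : 2 * (A - b) + B₁ * n⁻¹ + n * B₂ * (1 - x ^ 2) = (B₂ * n⁻¹) * (n ^ 2 * (1 - x ^ 2) + (2 * (A - b) / B₂) * n + p) := by
    rw [hB₁]; field_simp; ring
  rw [e, map_mul, map_mul, map_inv₀, hn, inv_one, mul_one]


/-- **Uniqueness of the norm class in the regime `ν = N₊ < 2m`** (Flicker: «`Δ` is uniquely determined modulo `π^{m−ν′}`»): two unit solutions `n₁, n₂` of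
`|n²(1−x²) + dn + ϖ^{2j}| ≤ |ϖ^k|` (`k, j ≥ 1`, `1 − x²` a unit) agree modulo `ϖ^k`: `E(n₁) − E(n₂) = (n₁ − n₂)·((n₁+n₂)(1−x²) + d)` and the second factor is a unit
because `d ≡ −n₁(1−x²) − ϖ^{2j}∕n₁`. [cite: Flicker1998UnitaryFL, Prop. 10 p. 86] -/
theorem v_sub_le_of_quadratic_gen (hd : LocalConjDatum σ ϖ) {n₁ n₂ x d p : K} {k : ℕ} (hk : 1 ≤ k) (hvp : Valued.v p < 1)
    (hn₁ : Valued.v n₁ = 1) (hn₂ : Valued.v n₂ = 1) (h1x : Valued.v (1 - x ^ 2) = 1)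
    (hE₁ : Valued.v (n₁ ^ 2 * (1 - x ^ 2) + d * n₁ + p) ≤ Valued.v (ϖ ^ k))
    (hE₂ : Valued.v (n₂ ^ 2 * (1 - x ^ 2) + d * n₂ + p) ≤ Valued.v (ϖ ^ k)) :
    Valued.v (n₁ - n₂) ≤ Valued.v (ϖ ^ k) := by
  have hn₁0 : n₁ ≠ 0 := fun h => by rw [h, map_zero] at hn₁; exact zero_ne_one hn₁
  set E₁ := n₁ ^ 2 * (1 - x ^ 2) + d * n₁ + p with hE₁def
  set E₂ := n₂ ^ 2 * (1 - x ^ 2) + d * n₂ + p with hE₂def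
  -- the bracket `(n₁+n₂)(1−x²) + d = n₂(1−x²) + (E₁ − ϖ^{2j})/n₁` is a unit
  have hbr : (n₁ + n₂) * (1 - x ^ 2) + d = n₂ * (1 - x ^ 2) + (E₁ - p) * n₁⁻¹ := by
    rw [hE₁def]; field_simp; ring
  have hk1 : Valued.v (ϖ ^ k) < 1 := by rw [hd.v_pow, ← WithZero.exp_zero, WithZero.exp_lt_exp]; omega
  have hj1 : Valued.v p < 1 := hvp
  have hsmall : Valued.v ((E₁ - p) * n₁⁻¹) < 1 := by
    rw [map_mul, map_inv₀, hn₁, inv_one, mul_one]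
    exact lt_of_le_of_lt (Valuation.map_sub _ _ _) (max_lt (lt_of_le_of_lt hE₁ hk1) hj1)
  have hmain : Valued.v (n₂ * (1 - x ^ 2)) = 1 := by rw [map_mul, hn₂, h1x, one_mul]
  have hunit : Valued.v ((n₁ + n₂) * (1 - x ^ 2) + d) = 1 := by
    rw [hbr, Valuation.map_add_eq_of_lt_left _ (by rw [hmain]; exact hsmall), hmain]
  have hfac : E₁ - E₂ = (n₁ - n₂) * ((n₁ + n₂) * (1 - x ^ 2) + d) := by rw [hE₁def, hE₂def]; ring
  have hdiff : Valued.v (E₁ - E₂) ≤ Valued.v (ϖ ^ k) := le_trans (Valuation.map_sub _ _ _) (max_le hE₁ hE₂)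
  rw [hfac, map_mul, hunit, mul_one] at hdiff
  exact hdiff


/-- **Regime «`m > ν` is empty» as a coset count**: for `τ = !![A,0,B₂ϖ^{2j}; 0,b,0; B₂,0,A] ∈ H` with `j ≥ 1` and `|ϖ^m| < |B₂|` (i.e. `m > ν`), NO coset of
`P_H ∩ H^K_m` in `P_H` conjugates `τ` into `H^K_m`: the count is `0` (★ `iTen`: `m > ν ≥ [ν∕2]` and `m ≤ ν` fails in the third case). [cite: Flicker1998UnitaryFL, Prop. 10 p. 86] -/
theorem natCard_cosets_eq_zero_of_lt_gen (hJ : J = (StdForm.antidiagonal 3).over K) (hd : LocalConjDatum σ ϖ) {y : K} (hy : y * σ y = -2) (m : ℕ)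
    {c um τ : ↥(unitaryGroupOfForm σ J)} (hc : ((c : GL (Fin 3) K) : Matrix (Fin 3) (Fin 3) K) = !![1, 0, 0; 0, -1, 0; 0, 0, 1])
    (hum : ((um : GL (Fin 3) K) : Matrix (Fin 3) (Fin 3) K) = !![ϖ ^ m, y, (ϖ ^ m)⁻¹; 0, 1, -σ y * (ϖ ^ m)⁻¹; 0, 0, (ϖ ^ m)⁻¹])
    {A B₁ B₂ b p : K} (hB₁ : B₁ = B₂ * p) (hvp : Valued.v p < 1) (hB₂0 : B₂ ≠ 0)
    (hτ : ((τ : GL (Fin 3) K) : Matrix (Fin 3) (Fin 3) K) = !![A, 0, B₁; 0, b, 0; B₂, 0, A])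
    (hτH : τ ∈ Subgroup.centralizer ({c} : Set ↥(unitaryGroupOfForm σ J))) (hlt : Valued.v (ϖ ^ m) < Valued.v B₂) :
    Nat.card {y : ↥(flickerPH σ J c) ⧸ (flickerHK σ J c um).subgroupOf (flickerPH σ J c) //
      ((Quotient.out y : ↥(flickerPH σ J c)) : ↥(unitaryGroupOfForm σ J))⁻¹ * τ * (Quotient.out y : ↥(flickerPH σ J c)) ∈ flickerHK σ J c um} = 0 := by
  have h2 : (2 : K) ≠ 0 := fun h => by have := hd.v2; rw [h, map_zero] at this; exact zero_ne_one this
  refine natCard_cosets_eq_zero_of_forall_not σ fun p hp hmem => ?_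
  obtain ⟨u, x, w, hpm, hvu, hvx, hσx, hvw, hσw⟩ := exists_coe_eq_borel_of_mem_flickerPH σ hJ hd hc hp
  have hu0 : u ≠ 0 := fun h => by rw [h, map_zero] at hvu; exact zero_ne_one hvu
  have hσu0 : σ u ≠ 0 := fun h => hu0 (by rw [← hd.σσ u, h, map_zero])
  have hw0 : w ≠ 0 := fun h => by rw [h, map_zero] at hvw; exact zero_ne_one hvw
  have hpH : p ∈ Subgroup.centralizer ({c} : Set ↥(unitaryGroupOfForm σ J)) := ((mem_flickerPH_iff h2 hc).1 hp).1.1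
  obtain ⟨-, h₂, h₃, h₄⟩ := (borel_conj_mem_flickerHK_iff σ hJ hd hy m hu0 hσu0 hw0 hum hpm hτ hpH hτH).1 hmem
  have hn : Valued.v (u * σ u) = 1 := by rw [map_mul, hd.vσ, hvu, mul_one]
  have := v_B₂_le_of_conditions_gen σ hd hvp hB₂0 hn hvx hB₁ h₂ h₃ h₄
  exact absurd hlt (not_lt.2 this)


/-- **Regime «no solution» as a coset count**: `m ≤ ν` (`|B₂| ≤ |t|`) but EITHER `N₊ < m` (`|t| < |A − b|`) OR the valuations `|A−b| ≠ |B₂|` with `max > |t|²`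
(`2m > min(ν, N₊)`, `ν ≠ N₊`): the count is `0`. [cite: Flicker1998UnitaryFL, Prop. 10 p. 86] -/
theorem natCard_cosets_eq_zero_of_ne_gen (hJ : J = (StdForm.antidiagonal 3).over K) (hd : LocalConjDatum σ ϖ) {y : K} (hy : y * σ y = -2) (m : ℕ)
    {c um τ : ↥(unitaryGroupOfForm σ J)} (hc : ((c : GL (Fin 3) K) : Matrix (Fin 3) (Fin 3) K) = !![1, 0, 0; 0, -1, 0; 0, 0, 1])
    (hum : ((um : GL (Fin 3) K) : Matrix (Fin 3) (Fin 3) K) = !![ϖ ^ m, y, (ϖ ^ m)⁻¹; 0, 1, -σ y * (ϖ ^ m)⁻¹; 0, 0, (ϖ ^ m)⁻¹])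
    {A B₁ B₂ b p : K} (hB₁ : B₁ = B₂ * p) (hvp : Valued.v p < 1) (hB₂0 : B₂ ≠ 0)
    (hτ : ((τ : GL (Fin 3) K) : Matrix (Fin 3) (Fin 3) K) = !![A, 0, B₁; 0, b, 0; B₂, 0, A])
    (hτH : τ ∈ Subgroup.centralizer ({c} : Set ↥(unitaryGroupOfForm σ J))) (hB₂m : Valued.v B₂ ≤ Valued.v (ϖ ^ m))
    (hbad : Valued.v (ϖ ^ m) < Valued.v (A - b) ∨
      (Valued.v (A - b) ≠ Valued.v B₂ ∧ Valued.v (ϖ ^ m) * Valued.v (ϖ ^ m) < max (Valued.v (A - b)) (Valued.v B₂))) :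
    Nat.card {y : ↥(flickerPH σ J c) ⧸ (flickerHK σ J c um).subgroupOf (flickerPH σ J c) //
      ((Quotient.out y : ↥(flickerPH σ J c)) : ↥(unitaryGroupOfForm σ J))⁻¹ * τ * (Quotient.out y : ↥(flickerPH σ J c)) ∈ flickerHK σ J c um} = 0 := by
  have h2 : (2 : K) ≠ 0 := fun h => by have := hd.v2; rw [h, map_zero] at this; exact zero_ne_one this
  refine natCard_cosets_eq_zero_of_forall_not σ fun p hp hmem => ?_
  obtain ⟨u, x, w, hpm, hvu, hvx, hσx, hvw, hσw⟩ := exists_coe_eq_borel_of_mem_flickerPH σ hJ hd hc hp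
  have hu0 : u ≠ 0 := fun h => by rw [h, map_zero] at hvu; exact zero_ne_one hvu
  have hσu0 : σ u ≠ 0 := fun h => hu0 (by rw [← hd.σσ u, h, map_zero])
  have hw0 : w ≠ 0 := fun h => by rw [h, map_zero] at hvw; exact zero_ne_one hvw
  have hpH : p ∈ Subgroup.centralizer ({c} : Set ↥(unitaryGroupOfForm σ J)) := ((mem_flickerPH_iff h2 hc).1 hp).1.1
  obtain ⟨-, h₂, h₃, h₄⟩ := (borel_conj_mem_flickerHK_iff σ hJ hd hy m hu0 hσu0 hw0 hum hpm hτ hpH hτH).1 hmem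
  have hn : Valued.v (u * σ u) = 1 := by rw [map_mul, hd.vσ, hvu, mul_one]
  rcases hbad with hs | ⟨hne, hbig⟩
  · have := (two_congruences_iff_of_v_B₂_le (ϖ := ϖ) hB₂m hn hvx).1 ⟨h₂, h₃⟩
    exact absurd hs (not_lt.2 this)
  · have h1x := v_one_sub_sq_eq_one σ hd.vσ hd.v2 hσx hvx
    exact not_condition_four_of_ne_gen σ hd hvp hB₂0 hn h1x hB₁ hne hbig h₄


/-- **Regime «everything solves» as a coset count**: if `|A − b| ≤ |t|²` and `|B₂| ≤ |t|²` (`2m ≤ N₊`, `2m ≤ ν`) then EVERY coset conjugates `τ` into `H^K_m`, and the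
count is the index `[P_H : P_H ∩ H^K_m]`. [cite: Flicker1998UnitaryFL, Prop. 10 p. 86; Prop. 8 p. 84] -/
theorem natCard_cosets_eq_index_of_le_gen (hJ : J = (StdForm.antidiagonal 3).over K) (hd : LocalConjDatum σ ϖ) {y : K} (hy : y * σ y = -2) (m : ℕ)
    {c um τ : ↥(unitaryGroupOfForm σ J)} (hc : ((c : GL (Fin 3) K) : Matrix (Fin 3) (Fin 3) K) = !![1, 0, 0; 0, -1, 0; 0, 0, 1])
    (hum : ((um : GL (Fin 3) K) : Matrix (Fin 3) (Fin 3) K) = !![ϖ ^ m, y, (ϖ ^ m)⁻¹; 0, 1, -σ y * (ϖ ^ m)⁻¹; 0, 0, (ϖ ^ m)⁻¹])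
    {A B₁ B₂ b p : K} (hB₁ : B₁ = B₂ * p) (hvp1 : Valued.v p ≤ 1)
    (hτ : ((τ : GL (Fin 3) K) : Matrix (Fin 3) (Fin 3) K) = !![A, 0, B₁; 0, b, 0; B₂, 0, A])
    (hτH : τ ∈ Subgroup.centralizer ({c} : Set ↥(unitaryGroupOfForm σ J)))
    (hs : Valued.v (A - b) ≤ Valued.v (ϖ ^ m) * Valued.v (ϖ ^ m)) (hB₂ : Valued.v B₂ ≤ Valued.v (ϖ ^ m) * Valued.v (ϖ ^ m)) :
    Nat.card {y : ↥(flickerPH σ J c) ⧸ (flickerHK σ J c um).subgroupOf (flickerPH σ J c) //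
      ((Quotient.out y : ↥(flickerPH σ J c)) : ↥(unitaryGroupOfForm σ J))⁻¹ * τ * (Quotient.out y : ↥(flickerPH σ J c)) ∈ flickerHK σ J c um} =
      ((flickerHK σ J c um).subgroupOf (flickerPH σ J c)).index := by
  have h2 : (2 : K) ≠ 0 := fun h => by have := hd.v2; rw [h, map_zero] at this; exact zero_ne_one this
  have ht1 : Valued.v (ϖ ^ m) ≤ 1 := hd.v_pow_le_one m
  have ht2 : Valued.v (ϖ ^ m) * Valued.v (ϖ ^ m) ≤ Valued.v (ϖ ^ m) := by simpa using mul_le_mul' ht1 (le_refl (Valued.v (ϖ ^ m)))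
  refine natCard_cosets_eq_index_of_forall σ fun p hp => ?_
  obtain ⟨u, x, w, hpm, hvu, hvx, hσx, hvw, hσw⟩ := exists_coe_eq_borel_of_mem_flickerPH σ hJ hd hc hp
  have hu0 : u ≠ 0 := fun h => by rw [h, map_zero] at hvu; exact zero_ne_one hvu
  have hσu0 : σ u ≠ 0 := fun h => hu0 (by rw [← hd.σσ u, h, map_zero])
  have hw0 : w ≠ 0 := fun h => by rw [h, map_zero] at hvw; exact zero_ne_one hvw
  have hpH : p ∈ Subgroup.centralizer ({c} : Set ↥(unitaryGroupOfForm σ J)) := ((mem_flickerPH_iff h2 hc).1 hp).1.1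
  have hn : Valued.v (u * σ u) = 1 := by rw [map_mul, hd.vσ, hvu, mul_one]
  have hB₂m : Valued.v B₂ ≤ Valued.v (ϖ ^ m) := le_trans hB₂ ht2
  refine (borel_conj_mem_flickerHK_iff σ hJ hd hy m hu0 hσu0 hw0 hum hpm hτ hpH hτH).2 ⟨?_, ?_⟩
  · rw [map_mul, hn, one_mul]; exact le_trans hB₂m ht1
  obtain ⟨h₂, h₃⟩ := (two_congruences_iff_of_v_B₂_le (ϖ := ϖ) hB₂m hn hvx).2 (le_trans hs ht2)
  exact ⟨h₂, h₃, condition_four_of_le_sq_gen σ hd hvp1 hn hvx hB₁ hs hB₂⟩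

end UnitaryGroup

end Literature.NumberTheory.Automorphic
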